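import Summits.QuantumFields.YangMills.Theorems.BalabanUVNodesN16OfSocketsZd3
import HarnessLib

/-!
# Route «BalabanUVNodes» (K3⁗ `SpineGivenEndpointR13Sep`), DAG node N16 = NE3 — THE R-β″ (MULTI-SCALE HÖLDER) TOPS OF THE N05 → N16 EDGE RE-KEYED AT THE
# ALL-TORUS PROPER MEMBERS of n05-a's family `zdGF3 (M_n ℂ) L β len` (companion of `BalabanUVNodesN16OfSocketsAllTorus`, which re-keys the β = 1 root)

Cell `pub-ymgap`, seat `pub-ymgap-dag-n16-c` (R134 fan-out seat, strategy s1; HUMAN RULING D-0062; chair R424 venue), generation 6, file 46 — over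
generation 4's files 33 ∕ 34 ∕ 36 (`N16HolderMSPrintOfLeaf.thm4TorusAt_zero_printMS_of_leaf_member`, `N16HolderMSOfLeaf.thm4TorusAt_printMS_of_leaf`,
`N16HolderMSOfLeafTop.n16_holderMS_of_leaf`), generation 5's file 42 (`N16OfSocketsZd3.n16_holderMS_of_socketsZd3E_l1Len`) and this generation's file 45.
`--supports stmt-QuantumFields-20292 --as helper` (K3⁗).  `bears_on: R4∕N16 · edge N05 → N16`.

WHY.  File 45 re-keys the β = 1 root after the certificate `B8SockH59NotAtUnivDegenerate.not_forall_univ_sockH59` (the univ-keyed `SockH59` binder is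
unsatisfiable).  The same binder makes generation 5's R-β″ tops `n16_holderMS_of_socketsZd3E_l1Len` ∕ `…HFP₄…` vacuous as stated.  THIS file re-keys the
multi-scale Hölder chain (any `β ∈ [0, 1]` — node N05's residual exponent, printed «β ≦ β₀ < 1») at the all-torus proper sub-index
`{i : ZdIdx 4 L // (∀ j, i.Ω j = univ) ∧ (∀ m j, i.Λs m j = {j = m}) ∧ (∀ m j, i.Λb m j = {j = m})}` (spelled inline), where N16 reads the leaf.

WHAT THIS FILE PROVES (kernel, theorems only, 0 `def`, 0 sorry):
* §1 `thm4TorusAt_zero_printMS_of_leaf_allTorus` (any `d ≥ 2`, C⋆-algebra `𝔸`) and `thm4TorusAt_printMS_of_leaf_allTorus` (`M_n ℂ`, `η = L^{−k}`) — files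
  33 ∕ 34 with the two leaf clauses read on the all-torus proper sub-family (file 33's `…_member` at the member of `exists_member_univ`).
* §2 `n16_holderMS_of_leafAllTorus` — file 36's `n16_holderMS_of_leaf` (conclusion `… → CovRootHolderMS 4 (sfClass 4 L N ε) L N b g C s₁ s₂ β dom`
  VERBATIM) on the all-torus proper sub-family.
* §3 ★ `n16_holderMS_of_socketsAllTorus_l1Len` — file 42's `n16_holderMS_of_socketsZd3E_l1Len` with n05-a's five sockets demanded AT THE ALL-TORUS PROPER
  MEMBERS ONLY (print's ℓ¹ length `B9Eq340HolderZd.l1Len`, both length letters discharged); conclusion VERBATIM; and `n16_holderMS_of_socketsHFP₄AllTorus_l1Len`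
  — the same in n04-b's plain fixed-point socket currency (`SockHFP₀`∕`SockHFP`, four thresholds; file 42's `…HFP₄…` re-keyed).

HONEST FRAMING: a re-key by name; nothing of Bałaban is proved here; the sockets at the all-torus proper members are node N05's ∕ N06's open obligations,
(H3ˢᵘᵖ) = N07's; N16 ∕ NE3 NOT discharged; count-neutral; one finite four-torus at fixed ε — NOT ℝ⁴, NOT infinite volume, NOT OS, NOT a mass gap, NOT Clay.
-/

set_option autoImplicit false

open scoped BigOperators Matrix Matrix.Norms.L2Operator
open NormedSpace

namespace Summit.QuantumFields.YangMills.BalabanUVNodes.N16HolderMSOfSocketsAllTorus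

open Literature.MathematicalPhysics.QuantumFieldTheory.Balaban1983to89
open B7Prop1Explicit B7Prop2Explicit
open B7Prop3Flat (c3)
open B7Eq78Linearization (conjR)
open B7Eq92Concrete (mgauge)
open B8Ineq132 (InAk covDerivFwd)
open B8Eq184Proof (cfgExp)
open B8Eq119TwistedAxial (Restr129)
open B8Eq133Hypotheses (Reg335Zd)
open B8Eq138LandauZd (IsLandau138 covLap)
open B9Eq340HolderZd (AdmPair mem_admPair l1Len one_le_l1Len)
open B8Thm4TorusAt (torusLam Thm4TorusAt)
open B8LeafModelZd (ZdIdx SockP5base SockP5 SockH59)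
open B8LeafModelZd3 (zdGF3 SockB9P3)
open B8LeafModelZdSockP5uE (SockP5uE)
open B8LeafModelZdOfHFP (SockHFP₀ SockHFP)
open B8LeafModelZd3NonVacuity (exists_member_univ)
open Summit.QuantumFields.BalabanUV.T4Continuum
open T4AveragingDeficitWall (Ad)
open MinimalActionClassSix (conjR_eq_Ad)
open BlockAverageCurrent (curConst)
open NE3RightInverseSupLetters (frameC)
open NE3.LeafIndexSockets (LeafH3sup)
open MinimalActionRate (sfClass)
open Summit.QuantumFields.YangMills.BalabanUVNodes.N16HolderMSDefs (CovRootHolderMS)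
open Summit.QuantumFields.YangMills.BalabanUVNodes.N16HolderMSPrintOfLeaf (thm4TorusAt_zero_printMS_of_leaf_member)
open Summit.QuantumFields.YangMills.BalabanUVNodes.N16HolderMSOfThm4Output (n16_holderMS_of_thm4TorusAt_printMS)
open Summit.QuantumFields.YangMills.BalabanUVNodes.N16HolderMSTorusOfZd (thm4TorusAt_printMS_of_zd)
open Summit.QuantumFields.YangMills.BalabanUVNodes.N16HolderMSOfLeafTop (n16_holderMS_of_thm4Zd_printMS)
open Summit.QuantumFields.YangMills.BalabanUVNodes.N16HolderMSOfLeafL1 (l1Len_nsmul_e)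
open Summit.QuantumFields.YangMills.BalabanUVNodes.N16.OfLeaf (exists_window_print thm4TorusAt_concl_congr)

noncomputable section

variable {d : ℕ}

/-! ## §1 Theorem 4 ∧ Proposition 3 on the ALL-TORUS PROPER sub-family ⟹ the multi-scale `ℤᵈ` reading (files 33 ∕ 34 re-keyed) -/

section General

variable {𝔸 : Type} [CStarAlgebra 𝔸] [Nontrivial 𝔸]

/-- **THE MULTI-SCALE `ℤᵈ` READING FROM THE LEAF ON THE ALL-TORUS PROPER SUB-FAMILY** — file 33's `thm4TorusAt_zero_printMS_of_leaf_univ` with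
`B8.Thm4Body` ∕ `B8.Prop3Body` read on `fun i ↦ zdGF3 𝔸 L β len i.1` over `{i // (∀ j, i.Ω j = univ) ∧ (∀ m j, i.Λs m j = {j = m}) ∧ (∀ m j, i.Λb m j =
{j = m})}`; at every `k ≥ 1`, `η > 0`, for every `Reg`: `Thm4TorusAt L k 0 η c₁′ (unitaryUnits 𝔸) Reg (Restr129 L k (torusLam k)) Concl_P^MS` ((1.36)₃ at
every admissible LINE pair, transport = line holonomy).  File 33's `…_member` at the member of `exists_member_univ`.
[cite: Balaban1985RegularSpaces, Thm 4 p.88, Prop. 3 p.87, (1.36) p.82, p.77 («Ω_j = T_η»); Balaban1985BackgroundPropagators, (3.40) p.397] -/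
theorem thm4TorusAt_zero_printMS_of_leaf_allTorus (hd2 : 2 ≤ d) {L : ℕ} (hL : 2 ≤ L) {β : ℝ} (hβ : 0 ≤ β) {len : Site d → ℝ}
    (hlen : ∀ v : Site d, 0 < len v → 1 ≤ len v) {c₁ c₁' B₁' cP C₂ B₀β : ℝ} {inp : B8.B9Inputs} (hB₁' : 0 < B₁')
    (hBB : 5 * (d : ℝ) * L * inp.B₀ ≤ B₁')
    (hwin : ∀ α₀ α₁ : ℝ, 0 < α₀ → 0 < α₁ → α₀ + α₁ ≤ c₁' →
      α₀ + α₁ ≤ c₁ ∧ C0 d * (2 * α₀) ≤ 1 / 3 ∧ 4 * α₀ ≤ c2' d L ∧ 16 * (B₁' * (α₀ + α₁)) ≤ 1 ∧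
      Real.exp (4 * (800 * ((d : ℝ) + 1) ^ 2 * ((d : ℝ) + 4)) * α₀) * (1 + 8 * (131072 * ((d : ℝ) + 1) ^ 2) * (B₁' * (α₀ + α₁))) ≤ 2 ∧
      2 * (B₁' * (α₀ + α₁)) ≤ c3 d L ∧ (d : ℝ) * L * α₁ ≤ 1 / 8 ∧ α₀ ≤ cP ∧ α₁ ≤ cP ∧ B₁' * (α₀ + α₁) ≤ cP ∧
      2 * (B₁' * (α₀ + α₁)) ^ 2 + 20 * d * α₀ * (B₁' * (α₀ + α₁)) + 2 * C₂ * (B₁' * (α₀ + α₁)) ^ 2 ≤ α₀ + α₁)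
    (hT : B8.Thm4Body c₁ B₁' (fun i : {i : ZdIdx d L // (∀ j, i.Ω j = Set.univ) ∧ (∀ m j, i.Λs m j = {_y | j = m}) ∧ (∀ m j, i.Λb m j = {_c | j = m})} =>
      (zdGF3 𝔸 L β len i.1).toGFData))
    (hP : B8.Prop3Body cP d (L : ℝ) C₂ inp B₀β (fun i : {i : ZdIdx d L // (∀ j, i.Ω j = Set.univ) ∧ (∀ m j, i.Λs m j = {_y | j = m}) ∧ (∀ m j, i.Λb m j = {_c | j = m})} =>
        (zdGF3 𝔸 L β len i.1).toGFData2))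
    {k : ℕ} (hk : 1 ≤ k) {η : ℝ} (hη : 0 < η) (Reg : (Site d → Fin d → 𝔸ˣ) → Prop) :
    Thm4TorusAt L k 0 η c₁' (unitaryUnits 𝔸) Reg (Restr129 L k (torusLam k))
      (fun (α₀ α₁ : ℝ) (U₀ U' : Site d → Fin d → 𝔸ˣ) (u : Site d → 𝔸ˣ) =>
        ∃ A : Site d → Fin d → 𝔸,
          (∀ x μ, IsSelfAdjoint (A x μ)) ∧ mgauge U₀ u (cfgExp η A) = U' ∧
          (∀ x μ, ‖A x μ‖ ≤ 5 * (d : ℝ) * L * inp.B₀ * (α₀ + α₁) * ((L : ℝ) ^ k * η)⁻¹) ∧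
          (∀ (μ : Fin d) (x : Site d) (κ : Fin d),
            ‖covDerivFwd η U₀ μ (fun z => A z κ) x‖ ≤ 5 * (d : ℝ) * L * inp.B₀ * (α₀ + α₁) * ((L : ℝ) ^ k * η) ^ (-(2 : ℝ))) ∧
          IsLandau138 L k η Set.univ (torusLam k) U₀ A ∧
          (∀ (κ μ : Fin d) (y : Site d) (j : ℕ), (y, y + j • e μ) ∈ AdmPair η len →
            ‖conjR (hol U₀ y (seg μ (j : ℤ))) (covDerivFwd η U₀ μ (fun z => A z κ) (y + j • e μ)) - covDerivFwd η U₀ μ (fun z => A z κ) y‖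
              ≤ 5 * (d : ℝ) * L * B₀β * (α₀ + α₁) * ((L : ℝ) ^ k * η) ^ (-(2 + β)) * (η * len (j • e μ)) ^ β) ∧
          (∀ (x : Site d) (κ : Fin d),
            ‖covLap η U₀ (fun z => A z κ) x‖ ≤ 5 * (d : ℝ) * L * inp.B₀ * (α₀ + α₁) * ((L : ℝ) ^ k * η) ^ (-(3 : ℝ)))) := by
  obtain ⟨i, -, hik, hiη, hΩ, hΛs, hΛb⟩ := exists_member_univ (d := d) (le_trans (by norm_num) hL) hk hη
  subst hik hiη
  exact thm4TorusAt_zero_printMS_of_leaf_member hd2 hL hβ hlen i hΩ hΛs hB₁' hBB hwin Reg (hT ⟨i, hΩ, hΛs, hΛb⟩)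
    (hP ⟨i, hΩ, hΛs, hΛb⟩)

end General

section Matrices

variable {n : Type} [Fintype n] [DecidableEq n]

/-- **THE LEAF CLAUSES ON THE ALL-TORUS PROPER SUB-FAMILY ⟹ THE MULTI-SCALE (T4^ℤᵈ_print-MS) AT `η = L^{−k}`, VERBATIM** (`𝔸 = M_n(ℂ)`; `d, L ≥ 2`;
`β ≥ 0`, `len ≥ 1` on its support with `len (j•e_μ) = j`): twin of file 34's `N16HolderMSOfLeaf.thm4TorusAt_printMS_of_leaf` (same proof, §1 in place of
the univ-family lemma). [cite: Balaban1985RegularSpaces, Thm 4 p.88, Prop. 3 p.87, (1.36)–(1.39) pp.82–83, p.77 («Ω_j = T_η»); Balaban1985BackgroundPropagators, (3.40) p.397] -/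
theorem thm4TorusAt_printMS_of_leaf_allTorus [Nonempty n] (hd2 : 2 ≤ d) {L : ℕ} (hL : 2 ≤ L) {β : ℝ} (hβ : 0 ≤ β) {len : Site d → ℝ}
    (hlen : ∀ v : Site d, 0 < len v → 1 ≤ len v) (hlenj : ∀ (μ : Fin d) (j : ℕ), len (j • e μ) = j) {c₁ c₁' B₁' cP C₂ B₀β : ℝ} {inp : B8.B9Inputs}
    (hB₁' : 0 < B₁') (hBB : 5 * (d : ℝ) * L * inp.B₀ ≤ B₁')
    (hwin : ∀ α₀ α₁ : ℝ, 0 < α₀ → 0 < α₁ → α₀ + α₁ ≤ c₁' →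
      α₀ + α₁ ≤ c₁ ∧ C0 d * (2 * α₀) ≤ 1 / 3 ∧ 4 * α₀ ≤ c2' d L ∧ 16 * (B₁' * (α₀ + α₁)) ≤ 1 ∧
      Real.exp (4 * (800 * ((d : ℝ) + 1) ^ 2 * ((d : ℝ) + 4)) * α₀) * (1 + 8 * (131072 * ((d : ℝ) + 1) ^ 2) * (B₁' * (α₀ + α₁))) ≤ 2 ∧
      2 * (B₁' * (α₀ + α₁)) ≤ c3 d L ∧ (d : ℝ) * L * α₁ ≤ 1 / 8 ∧ α₀ ≤ cP ∧ α₁ ≤ cP ∧ B₁' * (α₀ + α₁) ≤ cP ∧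
      2 * (B₁' * (α₀ + α₁)) ^ 2 + 20 * d * α₀ * (B₁' * (α₀ + α₁)) + 2 * C₂ * (B₁' * (α₀ + α₁)) ^ 2 ≤ α₀ + α₁)
    (Reg : ℕ → (Site d → Fin d → (Matrix n n ℂ)ˣ) → Prop) :
    letI : CStarAlgebra (Matrix n n ℂ) := {}
    B8.Thm4Body c₁ B₁' (fun i : {i : ZdIdx d L // (∀ j, i.Ω j = Set.univ) ∧ (∀ m j, i.Λs m j = {_y | j = m}) ∧ (∀ m j, i.Λb m j = {_c | j = m})} =>
      (zdGF3 (Matrix n n ℂ) L β len i.1).toGFData) →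
    B8.Prop3Body cP d (L : ℝ) C₂ inp B₀β (fun i : {i : ZdIdx d L // (∀ j, i.Ω j = Set.univ) ∧ (∀ m j, i.Λs m j = {_y | j = m}) ∧ (∀ m j, i.Λb m j = {_c | j = m})} =>
      (zdGF3 (Matrix n n ℂ) L β len i.1).toGFData2) →
    ∀ k, 1 ≤ k → Thm4TorusAt L k 0 (((L : ℝ) ^ k)⁻¹) c₁' (unitaryUnits (Matrix n n ℂ)) (Reg k) (Restr129 L k (torusLam k))
      (fun (α₀ α₁ : ℝ) (U₀ U' : Site d → Fin d → (Matrix n n ℂ)ˣ) (u : Site d → (Matrix n n ℂ)ˣ) =>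
        ∃ A : Site d → Fin d → Matrix n n ℂ,
          (∀ x μ, IsSelfAdjoint (A x μ)) ∧ mgauge U₀ u (cfgExp (((L : ℝ) ^ k)⁻¹) A) = U' ∧
          (∀ x μ, ‖A x μ‖ ≤ 5 * (d : ℝ) * L * inp.B₀ * (α₀ + α₁)) ∧
          (∀ (μ : Fin d) (x : Site d) (κ : Fin d),
            ‖covDerivFwd (((L : ℝ) ^ k)⁻¹) U₀ μ (fun z => A z κ) x‖ ≤ 5 * (d : ℝ) * L * inp.B₀ * (α₀ + α₁)) ∧
          IsLandau138 L k (((L : ℝ) ^ k)⁻¹) Set.univ (torusLam k) U₀ A ∧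
          (∀ (κ μ : Fin d) (y : Site d) (j : ℕ), 1 ≤ j → j ≤ L ^ k →
            ‖Ad (hol U₀ y (seg μ (j : ℤ))) (covDerivFwd (((L : ℝ) ^ k)⁻¹) U₀ μ (fun z => A z κ) (y + j • e μ))
                - covDerivFwd (((L : ℝ) ^ k)⁻¹) U₀ μ (fun z => A z κ) y‖
              ≤ 5 * (d : ℝ) * L * B₀β * (α₀ + α₁) * ((((L : ℝ)⁻¹) ^ k) ^ β * (j : ℝ) ^ β)) ∧
          (∀ (x : Site d) (κ : Fin d), ‖covLap (((L : ℝ) ^ k)⁻¹) U₀ (fun z => A z κ) x‖ ≤ 5 * (d : ℝ) * L * inp.B₀ * (α₀ + α₁))) := by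
  letI : CStarAlgebra (Matrix n n ℂ) := {}
  intro hT hP k hk
  have hL1 : 1 ≤ L := le_trans (by norm_num) hL
  have hL1r : (1 : ℝ) ≤ L := by exact_mod_cast hL1
  have hLk : (1 : ℝ) ≤ (L : ℝ) ^ k := one_le_pow₀ hL1r
  have hη : 0 < ((L : ℝ) ^ k)⁻¹ := by positivity
  have hη1 : ((L : ℝ) ^ k)⁻¹ ≤ 1 := inv_le_one_of_one_le₀ hLk
  have h := thm4TorusAt_zero_printMS_of_leaf_allTorus hd2 hL hβ hlen hB₁' hBB hwin hT hP hk hη (Reg k)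
  refine thm4TorusAt_concl_congr (fun α₀ α₁ U₀ U' u => ?_) h
  -- the letter identities at `η = L^{-k}`
  have hLk0 : (0 : ℝ) < (L : ℝ) ^ k := by positivity
  have hw : (L : ℝ) ^ k * ((L : ℝ) ^ k)⁻¹ = 1 := mul_inv_cancel₀ hLk0.ne'
  have hw2 : ((L : ℝ) ^ k * ((L : ℝ) ^ k)⁻¹) ^ (-(2 : ℝ)) = 1 := by rw [hw, Real.one_rpow]
  have hw3 : ((L : ℝ) ^ k * ((L : ℝ) ^ k)⁻¹) ^ (-(3 : ℝ)) = 1 := by rw [hw, Real.one_rpow]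
  have hwβ : ((L : ℝ) ^ k * ((L : ℝ) ^ k)⁻¹) ^ (-(2 + β)) = 1 := by rw [hw, Real.one_rpow]
  have hηβ : ∀ (μ : Fin d) (j : ℕ), (((L : ℝ) ^ k)⁻¹ * len (j • e μ)) ^ β = (((L : ℝ)⁻¹) ^ k) ^ β * (j : ℝ) ^ β := fun μ j => by
    rw [hlenj μ j, inv_pow, Real.mul_rpow (by positivity) (Nat.cast_nonneg j)]
  -- admissibility of the line pair `(y, y + j•e_μ)` iff `1 ≤ j ≤ L^k`
  have hadm : ∀ (μ : Fin d) (y : Site d) (j : ℕ), 1 ≤ j → j ≤ L ^ k → (y, y + j • e μ) ∈ AdmPair (((L : ℝ) ^ k)⁻¹) len := by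
    intro μ y j hj hjL
    rw [mem_admPair]
    simp only [add_sub_cancel_left, hlenj μ j]
    refine ⟨by exact_mod_cast hj, ?_⟩
    have hjr : (j : ℝ) ≤ (L : ℝ) ^ k := by exact_mod_cast hjL
    rw [← div_eq_inv_mul, div_le_one hLk0]
    exact hjr
  have hadm' : ∀ (μ : Fin d) (y : Site d) (j : ℕ), (y, y + j • e μ) ∈ AdmPair (((L : ℝ) ^ k)⁻¹) len → 1 ≤ j ∧ j ≤ L ^ k := by
    intro μ y j hp
    rw [mem_admPair] at hp
    simp only [add_sub_cancel_left, hlenj μ j] at hp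
    obtain ⟨hp1, hp2⟩ := hp
    refine ⟨by exact_mod_cast hp1, ?_⟩
    rw [← div_eq_inv_mul, div_le_one hLk0] at hp2
    exact_mod_cast hp2
  constructor
  · rintro ⟨A, h1, h2, h3, h4, h5, h6, h7⟩
    refine ⟨A, h1, h2, fun x μ => ?_, fun μ x κ => ?_, h5, fun κ μ y j hj hjL => ?_, fun x κ => ?_⟩
    · have h := h3 x μ; rwa [hw, inv_one, mul_one] at h
    · have h := h4 μ x κ; rwa [hw2, mul_one] at h
    · have h := h6 κ μ y j (hadm μ y j hj hjL); rwa [hwβ, mul_one, hηβ μ j] at h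
    · have h := h7 x κ; rwa [hw3, mul_one] at h
  · rintro ⟨A, h1, h2, h3, h4, h5, h6, h7⟩
    refine ⟨A, h1, h2, fun x μ => ?_, fun μ x κ => ?_, h5, fun κ μ y j hp => ?_, fun x κ => ?_⟩
    · rw [hw, inv_one, mul_one]; exact h3 x μ
    · rw [hw2, mul_one]; exact h4 μ x κ
    · obtain ⟨hj, hjL⟩ := hadm' μ y j hp
      rw [hwβ, mul_one, hηβ μ j]; exact h6 κ μ y j hj hjL
    · rw [hw3, mul_one]; exact h7 x κ

/-! ## §2 N16's multi-scale β-root from the leaf clauses on the all-torus proper sub-family and N07's (H3ˢᵘᵖ) -/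

/-- **N16 · THE MULTI-SCALE β-ROOT FROM THE [B8] LEAF ON THE ALL-TORUS PROPER SUB-FAMILY OF `zdGF3 (M_n(ℂ)) L β len` AND N07's (H3ˢᵘᵖ)** (`d = 4`,
`L ≥ 2`, `N ≥ 1`, ANY `β ∈ [0, 1]`): generation 4's `N16HolderMSOfLeafTop.n16_holderMS_of_leaf` with the two leaf clauses read over the ALL-TORUS PROPER
sub-index (instead of `{i // i.Ω 0 = univ}`); every other letter and the conclusion VERBATIM, ending in `LeafH3sup 4 L N ε b′ c′ dom →
CovRootHolderMS 4 (sfClass 4 L N ε) L N b g C s₁ s₂ β dom`.  N16 ∕ NE3 NOT proved: the two leaf clauses are node N05's theorems, (H3ˢᵘᵖ) is N07's.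
[cite: Balaban1985RegularSpaces, Thm 4 p.88, Prop. 3 p.87, (1.36) p.82] [folklore] -/
theorem n16_holderMS_of_leafAllTorus [Nonempty n] {L N : ℕ} (hL : 2 ≤ L) (hN : 1 ≤ N) :
    letI : CStarAlgebra (Matrix n n ℂ) := {}
    ∃ r : ℝ, 0 < r ∧ ∀ ⦃g : ℝ⦄, 0 < g → ∃ C : ℝ, 0 ≤ C ∧
      ∀ (c₁ c₁' B₁' cP C₂ B₀β : ℝ) (inp : B8.B9Inputs) (len : Site 4 → ℝ), (∀ v : Site 4, 0 < len v → 1 ≤ len v) →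
      (∀ (μ : Fin 4) (j : ℕ), len (j • e μ) = j) → 0 < B₁' → 5 * ((4 : ℕ) : ℝ) * L * inp.B₀ ≤ B₁' → 16 * (5 * ((4 : ℕ) : ℝ) * L * inp.B₀ * c₁') ≤ 1 →
      (∀ α₀ α₁ : ℝ, 0 < α₀ → 0 < α₁ → α₀ + α₁ ≤ c₁' →
        α₀ + α₁ ≤ c₁ ∧ C0 4 * (2 * α₀) ≤ 1 / 3 ∧ 4 * α₀ ≤ c2' 4 L ∧ 16 * (B₁' * (α₀ + α₁)) ≤ 1 ∧
        Real.exp (4 * (800 * (((4 : ℕ) : ℝ) + 1) ^ 2 * (((4 : ℕ) : ℝ) + 4)) * α₀) *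
            (1 + 8 * (131072 * (((4 : ℕ) : ℝ) + 1) ^ 2) * (B₁' * (α₀ + α₁))) ≤ 2 ∧
        2 * (B₁' * (α₀ + α₁)) ≤ c3 4 L ∧ ((4 : ℕ) : ℝ) * L * α₁ ≤ 1 / 8 ∧ α₀ ≤ cP ∧ α₁ ≤ cP ∧ B₁' * (α₀ + α₁) ≤ cP ∧
        2 * (B₁' * (α₀ + α₁)) ^ 2 + 20 * ((4 : ℕ) : ℝ) * α₀ * (B₁' * (α₀ + α₁)) + 2 * C₂ * (B₁' * (α₀ + α₁)) ^ 2 ≤ α₀ + α₁) →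
      ∀ ⦃b' c' : ℝ⦄, 0 ≤ b' → 0 ≤ c' →
      2 ^ 15 * ((4 : ℝ) + 1) ^ 2 * ((4 : ℝ) + 4) ^ 2 * (L : ℝ) ^ 2 * b' ≤ 1 →
      23040 * (4 : ℝ) ^ 4 * (frameC 4 L + 4) ^ 3 * (c' + curConst 4 L * b' ^ 2) ≤ 1 →
      ∀ ⦃α : ℝ⦄, 0 < α → C0 4 * α ≤ 1 / 3 → 2 * α ≤ c2' 4 L → 11 * (4 : ℝ) ^ 2 * α ≤ 1 / 6 → α + 11 * (4 : ℝ) ^ 2 * α ≤ c₁' →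
      b' + 226 * (8 * ((4 : ℝ) + 1) * ((4 : ℝ) + 4)) ^ 2 * b' ^ 2 < α → 4 * ((4 : ℝ) - 1) * (c' + curConst 4 L * b' ^ 2) < α →
      ∀ ⦃Mc : ℝ⦄, 0 ≤ Mc → (Mc + 1) * (b' + 226 * (8 * ((4 : ℝ) + 1) * ((4 : ℝ) + 4)) ^ 2 * b' ^ 2) ≤ 1 / 2 →
      ∀ (𝒬 : ℕ → Set (Set (Site 4) × ℕ)), (∀ k, ∀ q ∈ 𝒬 k, q.2 ≤ k ∧ ∃ y : Site 4, ∀ z ∈ q.1, (l1 (z - y) : ℝ) ≤ Mc * (L : ℝ) ^ q.2) →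
      ∀ ⦃C335 : ℝ⦄, 2 * (Mc + 1) * (b' + 226 * (8 * ((4 : ℝ) + 1) * ((4 : ℝ) + 4)) ^ 2 * b' ^ 2) + 2 * Mc * (2 * (c' + curConst 4 L * b' ^ 2)) +
        4 * Mc * (1 + 2 * Mc) * (b' + 226 * (8 * ((4 : ℝ) + 1) * ((4 : ℝ) + 4)) ^ 2 * b' ^ 2) ^ 2 < C335 →
      ∀ ⦃ε s₁ b s₂ : ℝ⦄, 0 < ε → ε ≤ r → ε < α → 0 ≤ s₁ → s₁ ≤ r → 0 ≤ b → b ≤ ε / 2 →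
      5 * ((4 : ℕ) : ℝ) * L * inp.B₀ * (α + 11 * (4 : ℝ) ^ 2 * α) ≤ s₁ →
      5 * ((4 : ℕ) : ℝ) * L * inp.B₀ * (α + 11 * (4 : ℝ) ^ 2 * α) +
          2 * (b' + 226 * (8 * ((4 : ℝ) + 1) * ((4 : ℝ) + 4)) ^ 2 * b' ^ 2) * s₁ ≤ s₁ →
      5 * ((4 : ℕ) : ℝ) * L * inp.B₀ * (α + 11 * (4 : ℝ) ^ 2 * α) + 16 * (b' + 226 * (8 * ((4 : ℝ) + 1) * ((4 : ℝ) + 4)) ^ 2 * b' ^ 2) *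
          (5 * ((4 : ℕ) : ℝ) * L * inp.B₀ * (α + 11 * (4 : ℝ) ^ 2 * α)) ≤ s₁ →
      5 * ((4 : ℕ) : ℝ) * L * B₀β * (α + 11 * (4 : ℝ) ^ 2 * α) + 10 * (b' + 226 * (8 * ((4 : ℝ) + 1) * ((4 : ℝ) + 4)) ^ 2 * b' ^ 2) *
          (5 * ((4 : ℕ) : ℝ) * L * inp.B₀ * (α + 11 * (4 : ℝ) ^ 2 * α)) ≤ s₂ →
      ∀ ⦃β : ℝ⦄, 0 ≤ β → β ≤ 1 →
      B8.Thm4Body c₁ B₁' (fun i : {i : ZdIdx 4 L // (∀ j, i.Ω j = Set.univ) ∧ (∀ m j, i.Λs m j = {_y | j = m}) ∧ (∀ m j, i.Λb m j = {_c | j = m})} =>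
        (zdGF3 (Matrix n n ℂ) L β len i.1).toGFData) →
      B8.Prop3Body cP 4 (L : ℝ) C₂ inp B₀β (fun i : {i : ZdIdx 4 L // (∀ j, i.Ω j = Set.univ) ∧ (∀ m j, i.Λs m j = {_y | j = m}) ∧ (∀ m j, i.Λb m j = {_c | j = m})} =>
        (zdGF3 (Matrix n n ℂ) L β len i.1).toGFData2) →
      ∀ {dom : _root_.Set (Site 4 → Fin 4 → (Matrix n n ℂ)ˣ)},
        LeafH3sup 4 L N ε b' c' dom →
        CovRootHolderMS 4 (sfClass 4 L N ε) L N b g C s₁ s₂ β dom := by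
  letI : CStarAlgebra (Matrix n n ℂ) := {}
  obtain ⟨r, hr0, hr⟩ := n16_holderMS_of_thm4Zd_printMS (n := n) hL hN
  refine ⟨r, hr0, fun g hg => ?_⟩
  obtain ⟨C, hC0, hC⟩ := hr hg
  refine ⟨C, hC0, fun c₁ c₁' B₁' cP C₂ B₀β inp len hlen hlen1 hB₁' hBB h16 hwin b' c' hb' hc' hRb hcF α hα hA3 hA2 hAs hAc hb'α hc'α Mc hMc
    hMcα 𝒬 h𝒬 C335 hC335 ε s₁ b s₂ hε hεr hεα hs₁ hs₁r hb hbh hss hgrad hℓ hhol β hβ0 hβ1 hT hP dom h3 => ?_⟩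
  have hB0 : 0 ≤ 5 * ((4 : ℕ) : ℝ) * L * inp.B₀ := by have := inp.B₀_pos.le; positivity
  have hT4 := thm4TorusAt_printMS_of_leaf_allTorus (d := 4) (by norm_num) hL hβ0 hlen hlen1 hB₁' hBB hwin
    (fun k => Reg335Zd (((L : ℝ) ^ k)⁻¹) L (𝒬 k) C335) hT hP
  exact hC c₁' (5 * ((4 : ℕ) : ℝ) * L * inp.B₀) (5 * ((4 : ℕ) : ℝ) * L * B₀β) hB0 h16 hb' hc' hRb hcF hα hA3 hA2 hAs hAc hb'α hc'α hMc
    hMcα 𝒬 h𝒬 hC335 hε hεr hεα hs₁ hs₁r hb hbh hss hgrad hℓ hhol hβ0 hβ1 hT4 h3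

/-! ## §3 ★ N16's multi-scale β-root from n05-a's five sockets AT THE ALL-TORUS PROPER MEMBERS ONLY (print's ℓ¹ length), and N07's (H3ˢᵘᵖ) -/

/-- ★ **N16 · THE MULTI-SCALE β-ROOT FROM NODE N05's FIVE SOCKETS ON THE ALL-TORUS PROPER SUB-FAMILY OF `zdGF3 (M_n(ℂ)) L β l1Len` AND N07's (H3ˢᵘᵖ)**
(`d = 4`, `L ≥ 2`, `N ≥ 1`, ANY `β ∈ [0,1]`; print's ℓ¹ length, both length letters discharged): generation 5's `n16_holderMS_of_socketsZd3E_l1Len` with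
the sockets `SockP5base ∕ SockP5 ∕ SockH59 ∕ SockP5uE ∕ SockB9P3` demanded at the all-torus proper members ONLY (instead of at every univ member, where the
`SockH59` family is unsatisfiable — file 45 §0).  Conclusion VERBATIM, ending in `LeafH3sup 4 L N ε b′ c′ dom → CovRootHolderMS 4 (sfClass 4 L N ε) L N b g C
s₁ s₂ β dom`.  n05-a's `thm4Printed_zd3_mapE` ∕ `prop3Printed_zd3_map` at `ι := Subtype.val` ∘ `n16_holderMS_of_leafAllTorus`.  N16 ∕ NE3 NOT proved.
[cite: Balaban1985RegularSpaces, Thm 4 p.88, Prop. 3 p.87, Prop. 5 p.94, (1.59) p.86, (1.36) p.82; Balaban1985BackgroundPropagators, (3.40) p.397] [folklore] -/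
theorem n16_holderMS_of_socketsAllTorus_l1Len [Nonempty n] {L N : ℕ} (hL : 2 ≤ L) (hN : 1 ≤ N) :
    letI : CStarAlgebra (Matrix n n ℂ) := {}
    ∃ r : ℝ, 0 < r ∧ ∀ ⦃g : ℝ⦄, 0 < g → ∃ C : ℝ, 0 ≤ C ∧
      ∀ ⦃β : ℝ⦄, 0 ≤ β → β ≤ 1 → ∀ (C₂ B₀ B₀' cu cP : ℝ) (inp : B8.B9Inputs) (B₀β : ℝ),
      0 < B₀ → inp.B₀ ≤ B₀ → 0 < B₀' → 2 ≤ 5 * ((4 : ℕ) : ℝ) * L * B₀ → 0 < cu → 0 < cP → 0 ≤ B₀β →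
      2097152 * (((4 : ℕ) : ℝ) + 1) ^ 2 ≤ C₂ →
      (∀ i : {i : ZdIdx 4 L // (∀ j, i.Ω j = Set.univ) ∧ (∀ m j, i.Λs m j = {_y | j = m}) ∧ (∀ m j, i.Λb m j = {_c | j = m})}, SockP5base (𝔸 := Matrix n n ℂ) L B₀ B₀' cP i.1.η i.1.k i.1.Ω i.1.Λs) →
      (∀ i : {i : ZdIdx 4 L // (∀ j, i.Ω j = Set.univ) ∧ (∀ m j, i.Λs m j = {_y | j = m}) ∧ (∀ m j, i.Λb m j = {_c | j = m})}, SockP5 (𝔸 := Matrix n n ℂ) L B₀ B₀' cP i.1.η i.1.k i.1.Ω i.1.Λs) →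
      (∀ i : {i : ZdIdx 4 L // (∀ j, i.Ω j = Set.univ) ∧ (∀ m j, i.Λs m j = {_y | j = m}) ∧ (∀ m j, i.Λb m j = {_c | j = m})}, SockH59 (𝔸 := Matrix n n ℂ) L B₀ B₀' cP i.1.η i.1.k i.1.Ω i.1.Λs i.1.Λb) →
      (∀ i : {i : ZdIdx 4 L // (∀ j, i.Ω j = Set.univ) ∧ (∀ m j, i.Λs m j = {_y | j = m}) ∧ (∀ m j, i.Λb m j = {_c | j = m})}, SockP5uE (𝔸 := Matrix n n ℂ) L B₀ cP cu i.1.η i.1.k i.1.Ω i.1.Λs) →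
      (∀ i : {i : ZdIdx 4 L // (∀ j, i.Ω j = Set.univ) ∧ (∀ m j, i.Λs m j = {_y | j = m}) ∧ (∀ m j, i.Λb m j = {_c | j = m})}, SockB9P3 (𝔸 := Matrix n n ℂ) L inp.B₀ B₀β cP β l1Len i.1.η i.1.k i.1.Ω i.1.Λs i.1.Λb) →
      ∃ c₁' : ℝ, 0 < c₁' ∧ 16 * (5 * ((4 : ℕ) : ℝ) * L * inp.B₀ * c₁') ≤ 1 ∧
      ∀ ⦃b' c' : ℝ⦄, 0 ≤ b' → 0 ≤ c' →
      2 ^ 15 * ((4 : ℝ) + 1) ^ 2 * ((4 : ℝ) + 4) ^ 2 * (L : ℝ) ^ 2 * b' ≤ 1 →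
      23040 * (4 : ℝ) ^ 4 * (frameC 4 L + 4) ^ 3 * (c' + curConst 4 L * b' ^ 2) ≤ 1 →
      ∀ ⦃α : ℝ⦄, 0 < α → C0 4 * α ≤ 1 / 3 → 2 * α ≤ c2' 4 L → 11 * (4 : ℝ) ^ 2 * α ≤ 1 / 6 → α + 11 * (4 : ℝ) ^ 2 * α ≤ c₁' →
      b' + 226 * (8 * ((4 : ℝ) + 1) * ((4 : ℝ) + 4)) ^ 2 * b' ^ 2 < α → 4 * ((4 : ℝ) - 1) * (c' + curConst 4 L * b' ^ 2) < α →
      ∀ ⦃Mc : ℝ⦄, 0 ≤ Mc → (Mc + 1) * (b' + 226 * (8 * ((4 : ℝ) + 1) * ((4 : ℝ) + 4)) ^ 2 * b' ^ 2) ≤ 1 / 2 →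
      ∀ (𝒬 : ℕ → Set (Set (Site 4) × ℕ)), (∀ k, ∀ q ∈ 𝒬 k, q.2 ≤ k ∧ ∃ y : Site 4, ∀ z ∈ q.1, (l1 (z - y) : ℝ) ≤ Mc * (L : ℝ) ^ q.2) →
      ∀ ⦃C335 : ℝ⦄, 2 * (Mc + 1) * (b' + 226 * (8 * ((4 : ℝ) + 1) * ((4 : ℝ) + 4)) ^ 2 * b' ^ 2) + 2 * Mc * (2 * (c' + curConst 4 L * b' ^ 2)) +
        4 * Mc * (1 + 2 * Mc) * (b' + 226 * (8 * ((4 : ℝ) + 1) * ((4 : ℝ) + 4)) ^ 2 * b' ^ 2) ^ 2 < C335 →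
      ∀ ⦃ε s₁ b s₂ : ℝ⦄, 0 < ε → ε ≤ r → ε < α → 0 ≤ s₁ → s₁ ≤ r → 0 ≤ b → b ≤ ε / 2 →
      5 * ((4 : ℕ) : ℝ) * L * inp.B₀ * (α + 11 * (4 : ℝ) ^ 2 * α) ≤ s₁ →
      5 * ((4 : ℕ) : ℝ) * L * inp.B₀ * (α + 11 * (4 : ℝ) ^ 2 * α) +
          2 * (b' + 226 * (8 * ((4 : ℝ) + 1) * ((4 : ℝ) + 4)) ^ 2 * b' ^ 2) * s₁ ≤ s₁ →
      5 * ((4 : ℕ) : ℝ) * L * inp.B₀ * (α + 11 * (4 : ℝ) ^ 2 * α) + 16 * (b' + 226 * (8 * ((4 : ℝ) + 1) * ((4 : ℝ) + 4)) ^ 2 * b' ^ 2) *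
          (5 * ((4 : ℕ) : ℝ) * L * inp.B₀ * (α + 11 * (4 : ℝ) ^ 2 * α)) ≤ s₁ →
      5 * ((4 : ℕ) : ℝ) * L * B₀β * (α + 11 * (4 : ℝ) ^ 2 * α) + 10 * (b' + 226 * (8 * ((4 : ℝ) + 1) * ((4 : ℝ) + 4)) ^ 2 * b' ^ 2) *
          (5 * ((4 : ℕ) : ℝ) * L * inp.B₀ * (α + 11 * (4 : ℝ) ^ 2 * α)) ≤ s₂ →
      ∀ {dom : _root_.Set (Site 4 → Fin 4 → (Matrix n n ℂ)ˣ)},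
        LeafH3sup 4 L N ε b' c' dom →
        CovRootHolderMS 4 (sfClass 4 L N ε) L N b g C s₁ s₂ β dom := by
  letI : CStarAlgebra (Matrix n n ℂ) := {}
  obtain ⟨r, hr0, hr⟩ := n16_holderMS_of_leafAllTorus (n := n) hL hN
  refine ⟨r, hr0, fun g hg => ?_⟩
  obtain ⟨C, hC0, hC⟩ := hr hg
  refine ⟨C, hC0, fun β hβ0 hβ1 C₂ B₀ B₀' cu cP inp B₀β hB₀ hiB hB₀' hB hcu hcP hB₀β hC₂ SP5base SP5 SH59 SP5u SB9 => ?_⟩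
  -- node N05's Theorem 4 ∕ Proposition 3 on the ALL-TORUS PROPER sub-family from the sockets there (n05-a, `ι := Subtype.val`)
  obtain ⟨c₁t, hc₁t, hT⟩ := B8LeafKnitZd3E.thm4Printed_zd3_mapE (𝔸 := Matrix n n ℂ) (d := 4) (by norm_num) hL (β := β)
    (len := l1Len) hB₀ hB₀' hB hcu hcP (fun i : {i : ZdIdx 4 L // (∀ j, i.Ω j = Set.univ) ∧ (∀ m j, i.Λs m j = {_y | j = m}) ∧ (∀ m j, i.Λb m j = {_c | j = m})} => i.1) SP5base SP5 SH59 SP5u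
  obtain ⟨cP', hcP', hP⟩ := B8LeafModelZd3Map.prop3Printed_zd3_map (𝔸 := Matrix n n ℂ) (d := 4) (by norm_num) hL inp hB₀β hC₂ hcP
    β l1Len (fun i : {i : ZdIdx 4 L // (∀ j, i.Ω j = Set.univ) ∧ (∀ m j, i.Λs m j = {_y | j = m}) ∧ (∀ m j, i.Λb m j = {_c | j = m})} => i.1) SB9
  -- the letter `B₁′ := 5·4·L·B₀` and the window threshold below the two printed thresholds
  have hLpos : (0 : ℝ) < L := by exact_mod_cast (show 0 < L by omega)
  have hB₁' : 0 < 5 * ((4 : ℕ) : ℝ) * L * B₀ := by positivity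
  have hBB : 5 * ((4 : ℕ) : ℝ) * L * inp.B₀ ≤ 5 * ((4 : ℕ) : ℝ) * L * B₀ := mul_le_mul_of_nonneg_left hiB (by positivity)
  obtain ⟨c₁', hc₁', hwin⟩ := exists_window_print (d := 4) (L := L) (by norm_num) hL C₂ hc₁t hcP' hB₁'
  have h16 : 16 * (5 * ((4 : ℕ) : ℝ) * L * inp.B₀ * c₁') ≤ 1 := by
    obtain ⟨-, -, -, h, -⟩ := hwin (c₁' / 2) (c₁' / 2) (by linarith) (by linarith) (by linarith)
    have h' : 16 * (5 * ((4 : ℕ) : ℝ) * L * B₀ * c₁') ≤ 1 := by rwa [add_halves] at h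
    nlinarith [mul_le_mul_of_nonneg_right hBB hc₁'.le]
  refine ⟨c₁', hc₁', h16, fun b' c' hb' hc' hRb hcF α hα hA3 hA2 hAs hAc hb'α hc'α Mc hMc hMcα 𝒬 h𝒬 C335 hC335 ε s₁ b s₂ hε hεr hεα hs₁
    hs₁r hb hbh hss hgrad hℓ hhol dom h3 => ?_⟩
  exact hC c₁t c₁' (5 * ((4 : ℕ) : ℝ) * L * B₀) cP' C₂ B₀β inp l1Len (fun v hv => one_le_l1Len hv) l1Len_nsmul_e hB₁' hBB h16 hwin hb' hc'
    hRb hcF hα hA3 hA2 hAs hAc hb'α hc'α hMc hMcα 𝒬 h𝒬 hC335 hε hεr hεα hs₁ hs₁r hb hbh hss hgrad hℓ hhol hβ0 hβ1 hT hP h3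

/-- ★ **THE SAME IN THE PROVIDERS' CURRENCY (PLAIN FIXED-POINT SOCKETS, FOUR INDEPENDENT THRESHOLDS) AT THE ALL-TORUS PROPER MEMBERS** (`d = 4`, `L ≥ 2`,
`N ≥ 1`, any `β ∈ [0,1]`, `len := l1Len`): generation 5's `n16_holderMS_of_socketsHFP₄_l1Len` (`SockHFP₀` at `cF₀`, `SockHFP` at `cF`, (1.59) `SockH59` at
`c59`, `SockP5uE` at `(cu′, cu)`, `SockB9P3` at `cP`; n05-a's `B8LeafKnitZd3E.thm4Printed_zd3_of_HFP₄_mapE`) with every socket demanded at the all-torus proper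
members ONLY; conclusion VERBATIM.  N16 ∕ NE3 NOT proved.
[cite: Balaban1985RegularSpaces, Thm 4 p.88, Prop. 3 p.87, Prop. 5 (1.106)–(1.109) p.94, (1.59) p.86; Balaban1985BackgroundPropagators, (3.40) p.397] [folklore] -/
theorem n16_holderMS_of_socketsHFP₄AllTorus_l1Len [Nonempty n] {L N : ℕ} (hL : 2 ≤ L) (hN : 1 ≤ N) :
    letI : CStarAlgebra (Matrix n n ℂ) := {}
    ∃ r : ℝ, 0 < r ∧ ∀ ⦃g : ℝ⦄, 0 < g → ∃ C : ℝ, 0 ≤ C ∧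
      ∀ ⦃β : ℝ⦄, 0 ≤ β → β ≤ 1 → ∀ (C₂ B₀ B₀' cu cF₀ cF c59 cu' cP : ℝ) (inp : B8.B9Inputs) (B₀β : ℝ),
      0 < B₀ → inp.B₀ ≤ B₀ → 0 < B₀' → 2 ≤ 5 * ((4 : ℕ) : ℝ) * L * B₀ → 0 < cu → 0 < cF₀ → 0 < cF → 0 < c59 → 0 < cu' → 0 < cP →
      0 ≤ B₀β → 2097152 * (((4 : ℕ) : ℝ) + 1) ^ 2 ≤ C₂ →
      (∀ i : {i : ZdIdx 4 L // (∀ j, i.Ω j = Set.univ) ∧ (∀ m j, i.Λs m j = {_y | j = m}) ∧ (∀ m j, i.Λb m j = {_c | j = m})}, SockHFP₀ (𝔸 := Matrix n n ℂ) L B₀ B₀' cF₀ i.1.η i.1.k i.1.Ω i.1.Λs) →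
      (∀ i : {i : ZdIdx 4 L // (∀ j, i.Ω j = Set.univ) ∧ (∀ m j, i.Λs m j = {_y | j = m}) ∧ (∀ m j, i.Λb m j = {_c | j = m})}, SockHFP (𝔸 := Matrix n n ℂ) L B₀ B₀' cF i.1.η i.1.k i.1.Ω i.1.Λs) →
      (∀ i : {i : ZdIdx 4 L // (∀ j, i.Ω j = Set.univ) ∧ (∀ m j, i.Λs m j = {_y | j = m}) ∧ (∀ m j, i.Λb m j = {_c | j = m})}, SockH59 (𝔸 := Matrix n n ℂ) L B₀ B₀' c59 i.1.η i.1.k i.1.Ω i.1.Λs i.1.Λb) →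
      (∀ i : {i : ZdIdx 4 L // (∀ j, i.Ω j = Set.univ) ∧ (∀ m j, i.Λs m j = {_y | j = m}) ∧ (∀ m j, i.Λb m j = {_c | j = m})}, SockP5uE (𝔸 := Matrix n n ℂ) L B₀ cu' cu i.1.η i.1.k i.1.Ω i.1.Λs) →
      (∀ i : {i : ZdIdx 4 L // (∀ j, i.Ω j = Set.univ) ∧ (∀ m j, i.Λs m j = {_y | j = m}) ∧ (∀ m j, i.Λb m j = {_c | j = m})}, SockB9P3 (𝔸 := Matrix n n ℂ) L inp.B₀ B₀β cP β l1Len i.1.η i.1.k i.1.Ω i.1.Λs i.1.Λb) →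
      ∃ c₁' : ℝ, 0 < c₁' ∧ 16 * (5 * ((4 : ℕ) : ℝ) * L * inp.B₀ * c₁') ≤ 1 ∧
      ∀ ⦃b' c' : ℝ⦄, 0 ≤ b' → 0 ≤ c' →
      2 ^ 15 * ((4 : ℝ) + 1) ^ 2 * ((4 : ℝ) + 4) ^ 2 * (L : ℝ) ^ 2 * b' ≤ 1 →
      23040 * (4 : ℝ) ^ 4 * (frameC 4 L + 4) ^ 3 * (c' + curConst 4 L * b' ^ 2) ≤ 1 →
      ∀ ⦃α : ℝ⦄, 0 < α → C0 4 * α ≤ 1 / 3 → 2 * α ≤ c2' 4 L → 11 * (4 : ℝ) ^ 2 * α ≤ 1 / 6 → α + 11 * (4 : ℝ) ^ 2 * α ≤ c₁' →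
      b' + 226 * (8 * ((4 : ℝ) + 1) * ((4 : ℝ) + 4)) ^ 2 * b' ^ 2 < α → 4 * ((4 : ℝ) - 1) * (c' + curConst 4 L * b' ^ 2) < α →
      ∀ ⦃Mc : ℝ⦄, 0 ≤ Mc → (Mc + 1) * (b' + 226 * (8 * ((4 : ℝ) + 1) * ((4 : ℝ) + 4)) ^ 2 * b' ^ 2) ≤ 1 / 2 →
      ∀ (𝒬 : ℕ → Set (Set (Site 4) × ℕ)), (∀ k, ∀ q ∈ 𝒬 k, q.2 ≤ k ∧ ∃ y : Site 4, ∀ z ∈ q.1, (l1 (z - y) : ℝ) ≤ Mc * (L : ℝ) ^ q.2) →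
      ∀ ⦃C335 : ℝ⦄, 2 * (Mc + 1) * (b' + 226 * (8 * ((4 : ℝ) + 1) * ((4 : ℝ) + 4)) ^ 2 * b' ^ 2) + 2 * Mc * (2 * (c' + curConst 4 L * b' ^ 2)) +
        4 * Mc * (1 + 2 * Mc) * (b' + 226 * (8 * ((4 : ℝ) + 1) * ((4 : ℝ) + 4)) ^ 2 * b' ^ 2) ^ 2 < C335 →
      ∀ ⦃ε s₁ b s₂ : ℝ⦄, 0 < ε → ε ≤ r → ε < α → 0 ≤ s₁ → s₁ ≤ r → 0 ≤ b → b ≤ ε / 2 →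
      5 * ((4 : ℕ) : ℝ) * L * inp.B₀ * (α + 11 * (4 : ℝ) ^ 2 * α) ≤ s₁ →
      5 * ((4 : ℕ) : ℝ) * L * inp.B₀ * (α + 11 * (4 : ℝ) ^ 2 * α) +
          2 * (b' + 226 * (8 * ((4 : ℝ) + 1) * ((4 : ℝ) + 4)) ^ 2 * b' ^ 2) * s₁ ≤ s₁ →
      5 * ((4 : ℕ) : ℝ) * L * inp.B₀ * (α + 11 * (4 : ℝ) ^ 2 * α) + 16 * (b' + 226 * (8 * ((4 : ℝ) + 1) * ((4 : ℝ) + 4)) ^ 2 * b' ^ 2) *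
          (5 * ((4 : ℕ) : ℝ) * L * inp.B₀ * (α + 11 * (4 : ℝ) ^ 2 * α)) ≤ s₁ →
      5 * ((4 : ℕ) : ℝ) * L * B₀β * (α + 11 * (4 : ℝ) ^ 2 * α) + 10 * (b' + 226 * (8 * ((4 : ℝ) + 1) * ((4 : ℝ) + 4)) ^ 2 * b' ^ 2) *
          (5 * ((4 : ℕ) : ℝ) * L * inp.B₀ * (α + 11 * (4 : ℝ) ^ 2 * α)) ≤ s₂ →
      ∀ {dom : _root_.Set (Site 4 → Fin 4 → (Matrix n n ℂ)ˣ)},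
        LeafH3sup 4 L N ε b' c' dom →
        CovRootHolderMS 4 (sfClass 4 L N ε) L N b g C s₁ s₂ β dom := by
  letI : CStarAlgebra (Matrix n n ℂ) := {}
  obtain ⟨r, hr0, hr⟩ := n16_holderMS_of_leafAllTorus (n := n) hL hN
  refine ⟨r, hr0, fun g hg => ?_⟩
  obtain ⟨C, hC0, hC⟩ := hr hg
  refine ⟨C, hC0, fun β hβ0 hβ1 C₂ B₀ B₀' cu cF₀ cF c59 cu' cP inp B₀β hB₀ hiB hB₀' hB hcu hcF₀ hcF hc59 hcu' hcP hB₀β hC₂ SHFP₀ SHFP SH59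
    SP5u SB9 => ?_⟩
  -- node N05's Theorem 4 ∕ Proposition 3 on the ALL-TORUS PROPER sub-family from the sockets there (n05-a, `ι := Subtype.val`)
  obtain ⟨c₁t, hc₁t, hT⟩ := B8LeafKnitZd3E.thm4Printed_zd3_of_HFP₄_mapE (𝔸 := Matrix n n ℂ) (d := 4) (by norm_num) hL (β := β)
    (len := l1Len) hB₀ hB₀' hB hcu hcF₀ hcF hc59 hcu' (fun i : {i : ZdIdx 4 L // (∀ j, i.Ω j = Set.univ) ∧ (∀ m j, i.Λs m j = {_y | j = m}) ∧ (∀ m j, i.Λb m j = {_c | j = m})} => i.1) SHFP₀ SHFP SH59 SP5u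
  obtain ⟨cP', hcP', hP⟩ := B8LeafModelZd3Map.prop3Printed_zd3_map (𝔸 := Matrix n n ℂ) (d := 4) (by norm_num) hL inp hB₀β hC₂ hcP
    β l1Len (fun i : {i : ZdIdx 4 L // (∀ j, i.Ω j = Set.univ) ∧ (∀ m j, i.Λs m j = {_y | j = m}) ∧ (∀ m j, i.Λb m j = {_c | j = m})} => i.1) SB9
  -- the letter `B₁′ := 5·4·L·B₀` and the window threshold below the two printed thresholds
  have hLpos : (0 : ℝ) < L := by exact_mod_cast (show 0 < L by omega)
  have hB₁' : 0 < 5 * ((4 : ℕ) : ℝ) * L * B₀ := by positivity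
  have hBB : 5 * ((4 : ℕ) : ℝ) * L * inp.B₀ ≤ 5 * ((4 : ℕ) : ℝ) * L * B₀ := mul_le_mul_of_nonneg_left hiB (by positivity)
  obtain ⟨c₁', hc₁', hwin⟩ := exists_window_print (d := 4) (L := L) (by norm_num) hL C₂ hc₁t hcP' hB₁'
  have h16 : 16 * (5 * ((4 : ℕ) : ℝ) * L * inp.B₀ * c₁') ≤ 1 := by
    obtain ⟨-, -, -, h, -⟩ := hwin (c₁' / 2) (c₁' / 2) (by linarith) (by linarith) (by linarith)
    have h' : 16 * (5 * ((4 : ℕ) : ℝ) * L * B₀ * c₁') ≤ 1 := by rwa [add_halves] at h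
    nlinarith [mul_le_mul_of_nonneg_right hBB hc₁'.le]
  refine ⟨c₁', hc₁', h16, fun b' c' hb' hc' hRb hcF α hα hA3 hA2 hAs hAc hb'α hc'α Mc hMc hMcα 𝒬 h𝒬 C335 hC335 ε s₁ b s₂ hε hεr hεα hs₁
    hs₁r hb hbh hss hgrad hℓ hhol dom h3 => ?_⟩
  exact hC c₁t c₁' (5 * ((4 : ℕ) : ℝ) * L * B₀) cP' C₂ B₀β inp l1Len (fun v hv => one_le_l1Len hv) l1Len_nsmul_e hB₁' hBB h16 hwin hb' hc'
    hRb hcF hα hA3 hA2 hAs hAc hb'α hc'α hMc hMcα 𝒬 h𝒬 hC335 hε hεr hεα hs₁ hs₁r hb hbh hss hgrad hℓ hhol hβ0 hβ1 hT hP h3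

end Matrices

end

end Summit.QuantumFields.YangMills.BalabanUVNodes.N16HolderMSOfSocketsAllTorus
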